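import Summits.HodgeConjecture.HodgeConjecture.Theorems.HLiu418ChiSplittingMirror
import Literature.NumberTheory.Automorphic.Liu2021.ThetaLiftFromLineMeets
import Literature.NumberTheory.Weil1964.AdelicSchrodingerConj
import HarnessLib

/-!
# `conj θ_{Φ,λ,⟨a⟩} = θ_{Φ̄,λ₂,⟨−a⟩}` for `λ̃₂ = λ̃⁻¹`: the conjugation law of the line theta kernels at the SPLITTING level — organ (O44c), layer (c1)

Track B ∕ hLiu418 = stmt-HodgeConjecture-24832, line `K2_Liu_CurveThetaSigs`, unit U6 (ED. 4 → ED. 5, package (B): hypothesis-side kernels at `lam⁻¹`,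
conclusion kernels at `lam`), socket #44∕45(R) `sig_K2LiuUndoublingSeparation`, organ (O44c) «conj-symmetry of line theta kernels
`conj θ_{Φ,λ}(g,q) = θ_{Φ̄,λ̄}(g,q)`, `λ̄ = λ⁻¹`»; seat `hodgecm-mathlib-K2Liu-p03` (g2); LEAD F0P6-plan GO 2026-09-03 23:34Z.
Layer (c0′) is ★ `Theorems/K2LiuLineThetaKernelConj` (model level: `conj θ_Φ(x,q) = Θ(ω_{−T}((s_{λ,a}(x⁻¹,q⁻¹))ᶜ) Φ̄)`); THIS file is layer (c1):
the conjugate element IS the splitting of the mirror line — ★ `HLiu418ChiSplittingMirror.mirror_chiSplittingLine`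
(`splittingCongr (mirrorSplitting ι_χ⟨a⟩) = ι_{χ⁻¹}⟨−a⟩`, ROAD U, [Kudla1994 Thm 3.1] uniqueness of the `χ⁻¹`-normalised doubled Weil representation) and ★
`HLiu418UndoublingMirror.omega_splittingCongr_mirrorSplitting_apply` (`ω(splittingCongr (mirrorSplitting s) g₂) Ψ = C (ω(s g) (C Ψ))` for `g₂, g` with the
same matrix) — so that, with `Θ(C Ψ) = conj Θ(Ψ)` (★ `thetaDistLM_piSchwartzBruhatConj`):

* `conj_lineThetaKer_mk_eq_neg` — for conjugate-symplectic `λ, λ₂` with `toHeckeCharacter λ₂ = (toHeckeCharacter λ)⁻¹` (e.g. `λ₂ = λ⁻¹`, or `λ₂ = λᶜ`),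
  a unit `a`, majorants `hρ, hρ₂` of the two data, `x ∈ U(diag dV)(𝔸)`, and `q ∈ U(⟨a⟩)(𝔸)`, `q₂ ∈ U(⟨−a⟩)(𝔸)` with the SAME matrix:
  **`conj ((lineThetaKernelDatum … lam hlam a hρ).thetaKer Φ (mk x, mk q)) = (lineThetaKernelDatum … lam₂ hlam₂ (−a) hρ₂).thetaKer (C Φ) (mk x, mk q₂)`**
  — rank `N` GENERIC (the curve sockets use `N = 2`, D8's doubled kernels `N = 4`).

No definition, no instance, no named fact; axioms ⊆ {propext, Classical.choice, Quot.sound}.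

## References
* Y. Liu, *Fourier–Jacobi cycles and arithmetic relative trace formula*, Camb. J. Math. 9 (2021), App. D Lemma D.1 (2), §D.1 Steps 1–3 [Liu2021].
* S. Kudla, *Splitting metaplectic covers of dual reductive pairs*, Israel J. Math. 87 (1994), §3 Thm. 3.1 [Kudla1994].
* J.-S. Li, J. reine angew. Math. 428 (1992), p. 181 (`ω* = ω_{ψ̄}`) [Li1992].
* A. Weil, Acta Math. 111 (1964), Chap. III n° 41 Thm 6 p. 193 [Weil1964].

HONEST LABEL: HC_CM is proved only modulo the 7 printed citations (2 remaining named inputs: hLiu418 =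
stmt-HodgeConjecture-24832, h413 = stmt-HodgeConjecture-24833) until rung 0 closes; this helper moves no counter.
-/

noncomputable section

set_option autoImplicit false

set_option linter.dupNamespace false

open scoped Classical
open scoped Matrix ComplexConjugate Kronecker
open NumberField IsDedekindDomain

namespace Summit.HodgeConjecture.HodgeConjecture.Cruxes.HLiu418.K2LiuLineThetaKernelMirror

open Literature.RepresentationTheory.HeisenbergGroup
open Literature.NumberTheory.Automorphic Literature.NumberTheory.Automorphic.UnitaryGroup
open Literature.NumberTheory.Automorphic.IdeleClassGroup
open Literature.NumberTheory.Weil1964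
open Literature.NumberTheory.GaloisRepresentations
open Literature.NumberTheory.GelbartRogawski1991 Literature.NumberTheory.GelbartRogawski1991.UnitaryDualPair
open Literature.NumberTheory.GelbartRogawski1991.GRConstruction
open Literature.NumberTheory.Automorphic.Liu2021 Literature.NumberTheory.Automorphic.Liu2021.Def411WeilCarriers
open Literature.NumberTheory.Automorphic.Liu2021.Def411WeilCarriersDoubling
open Literature.RepresentationTheory.Liu2021
open HodgeCM.WeilCoinv (mirrorSplitting mirrorSplitting_apply adelicGram_neg)
open Summit.HodgeConjecture.HodgeConjecture.Cruxes.HLiu418.DoubledWeilMirror (neg_TW neg_JW mirror_chiSplittingLine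
  omega_splittingCongr_mirrorSplitting_apply)

variable (L : Type) [Field L] [NumberField L] [IsCMField L] (N : ℕ) {n' : ℕ} (e₁ : Fin N × Fin 1 ≃ Fin n')
  (dV : Fin N → L) (hdV : ∀ i, IsCMField.complexConj L (dV i) = dV i) (hdV0 : ∀ i, dV i ≠ 0)

/-- **The pair elements `(x⁻¹ ⊗ 1)(1 ⊗ q₂⁻¹)` over `⟨−a⟩` and `(x⁻¹ ⊗ 1)(1 ⊗ q⁻¹)` over `⟨a⟩` have the same matrix** when `q₂` and `q` do
(★ `coe_adelicInl`, ★ `coe_adelicInr`). [cite: Kudla1994, §2] -/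
theorem coe_pairElem_eq (a : (Fp L)ˣ) (x : ↥(UnitaryGroup.adelic (Fp L) L (IsCMField.complexConj L) N (Matrix.diagonal dV)))
    (q : ↥(UnitaryGroup.adelic (Fp L) L (IsCMField.complexConj L) 1 (JW (Fp L) L a)))
    (q₂ : ↥(UnitaryGroup.adelic (Fp L) L (IsCMField.complexConj L) 1 (JW (Fp L) L (-a))))
    (hq : (q₂ : GL (Fin 1) (AdeleRing (𝓞 L) L)) = (q : GL (Fin 1) (AdeleRing (𝓞 L) L))) :
    ((UnitaryGroup.adelicInl (Fp L) L (IsCMField.complexConj L) N 1 (Matrix.diagonal dV) (JW (Fp L) L (-a)) x⁻¹ *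
          UnitaryGroup.adelicInr (Fp L) L (IsCMField.complexConj L) N 1 (Matrix.diagonal dV) (JW (Fp L) L (-a)) q₂⁻¹ :
        UnitaryGroup.adelicPair (Fp L) L (IsCMField.complexConj L) N 1 (Matrix.diagonal dV) (JW (Fp L) L (-a))) :
        GL (Fin N × Fin 1) (AdeleRing (𝓞 L) L)) =
      ((UnitaryGroup.adelicInl (Fp L) L (IsCMField.complexConj L) N 1 (Matrix.diagonal dV) (JW (Fp L) L a) x⁻¹ *
          UnitaryGroup.adelicInr (Fp L) L (IsCMField.complexConj L) N 1 (Matrix.diagonal dV) (JW (Fp L) L a) q⁻¹ :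
        UnitaryGroup.adelicPair (Fp L) L (IsCMField.complexConj L) N 1 (Matrix.diagonal dV) (JW (Fp L) L a)) :
        GL (Fin N × Fin 1) (AdeleRing (𝓞 L) L)) := by
  have hq' : ((q₂⁻¹ : ↥(UnitaryGroup.adelic (Fp L) L (IsCMField.complexConj L) 1 (JW (Fp L) L (-a)))) : GL (Fin 1) (AdeleRing (𝓞 L) L)) =
      ((q⁻¹ : ↥(UnitaryGroup.adelic (Fp L) L (IsCMField.complexConj L) 1 (JW (Fp L) L a))) : GL (Fin 1) (AdeleRing (𝓞 L) L)) := by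
    rw [Subgroup.coe_inv, Subgroup.coe_inv, hq]
  apply Units.ext
  rw [Subgroup.coe_mul, Subgroup.coe_mul, Units.val_mul, Units.val_mul, UnitaryGroup.coe_adelicInl, UnitaryGroup.coe_adelicInl,
    UnitaryGroup.coe_adelicInr, UnitaryGroup.coe_adelicInr, hq']

/-- **The line theta kernel in model currency** (layer (c0), restated from ★ `thetaKernelDatum_thetaFun_mk` ∕ ★ `ThetaKernelDatum.thetaKer_mk`, with the
pair splitting `s_pair(x, q) = s((x ⊗ 1)(1 ⊗ q))` unfolded, ★ `pairSplitting_apply`): `θ_{Φ,λ,a}(mk x, mk q) = Θ(ω_T(s_{λ,a}((x⁻¹ ⊗ 1)(1 ⊗ q⁻¹))) Φ)`.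
[cite: Weil1964, Chap. III n° 41 Thm 6 p. 193] -/
theorem lineThetaKer_mk_eq_thetaDistLM (lam : Literature.NumberTheory.Automorphic.IdeleClassGroup L →ₜ* Circle) (hlam : IsConjugateSymplectic L lam) (a : (Fp L)ˣ)
    (hρ : HasThetaMajorants fun
      (p : ↥(UnitaryGroup.adelic (Fp L) L (IsCMField.complexConj L) N (Matrix.diagonal dV)) ×
        ↥(UnitaryGroup.adelic (Fp L) L (IsCMField.complexConj L) 1 (JW (Fp L) L a)))
      (Φ : piSchwartzBruhat (Fp L) (Fin n')) =>
        pairRep (Fp L) L (IsCMField.complexConj L) N 1 e₁ (Matrix.diagonal dV) (JW (Fp L) L a)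
          (chiSplittingLine L e₁ dV hdV hdV0 (toHeckeCharacter L lam) (isUnitary_toHeckeCharacter L lam)
            ((isOscillatorChar_toHeckeCharacter_iff lam).mpr hlam) (TW (Fp L) a) (isUnit_det_TW (Fp L) a) (JW (Fp L) L a) (JW_eq (Fp L) L a))
          p Φ)
    (Φ : piSchwartzBruhat (Fp L) (Fin n')) (x : ↥(UnitaryGroup.adelic (Fp L) L (IsCMField.complexConj L) N (Matrix.diagonal dV)))
    (q : ↥(UnitaryGroup.adelic (Fp L) L (IsCMField.complexConj L) 1 (JW (Fp L) L a))) :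
    (lineThetaKernelDatum L N e₁ dV hdV hdV0 lam hlam a hρ).thetaKer Φ (QuotientGroup.mk x, QuotientGroup.mk q) =
      thetaDistLM (Fp L) (Fin n') (adelicMpCont.omega (Fp L) (Fin n') (adelicGram (Fp L) e₁ (realDiagonal L dV hdV) (TW (Fp L) a))
        (chiSplittingLine L e₁ dV hdV hdV0 (toHeckeCharacter L lam) (isUnitary_toHeckeCharacter L lam)
            ((isOscillatorChar_toHeckeCharacter_iff lam).mpr hlam) (TW (Fp L) a) (isUnit_det_TW (Fp L) a) (JW (Fp L) L a) (JW_eq (Fp L) L a)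
          (UnitaryGroup.adelicInl (Fp L) L (IsCMField.complexConj L) N 1 (Matrix.diagonal dV) (JW (Fp L) L a) x⁻¹ *
            UnitaryGroup.adelicInr (Fp L) L (IsCMField.complexConj L) N 1 (Matrix.diagonal dV) (JW (Fp L) L a) q⁻¹)) Φ) := by
  have h1 := ThetaKernelDatum.thetaKer_mk (lineThetaKernelDatum L N e₁ dV hdV hdV0 lam hlam a hρ) Φ x q
  have h2 := ThetaKernelDatum.thetaFun_apply (lineThetaKernelDatum L N e₁ dV hdV hdV0 lam hlam a hρ) Φ (x, q)
  have h3 : (lineThetaKernelDatum L N e₁ dV hdV hdV0 lam hlam a hρ).thetaFun Φ (x, q) =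
      thetaDistLM (Fp L) (Fin n') (adelicMpCont.omega (Fp L) (Fin n') (adelicGram (Fp L) e₁ (realDiagonal L dV hdV) (TW (Fp L) a))
        (chiSplittingLine L e₁ dV hdV hdV0 (toHeckeCharacter L lam) (isUnitary_toHeckeCharacter L lam)
            ((isOscillatorChar_toHeckeCharacter_iff lam).mpr hlam) (TW (Fp L) a) (isUnit_det_TW (Fp L) a) (JW (Fp L) L a) (JW_eq (Fp L) L a)
          (UnitaryGroup.adelicInl (Fp L) L (IsCMField.complexConj L) N 1 (Matrix.diagonal dV) (JW (Fp L) L a) x⁻¹ *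
            UnitaryGroup.adelicInr (Fp L) L (IsCMField.complexConj L) N 1 (Matrix.diagonal dV) (JW (Fp L) L a) q⁻¹)) Φ) :=
    thetaKernelDatum_thetaFun_mk (Fp L) L (IsCMField.complexConj L) N 1 e₁ (Matrix.diagonal dV) (JW (Fp L) L a)
      (complexConj_imagUnit L) (imagUnit_ne_zero L) (imagUnit_mul_self L) (realDiagonal_isSymm L dV hdV) (isSymm_TW (Fp L) a)
      (isUnit_det_realDiagonal L dV hdV hdV0) (isUnit_det_TW (Fp L) a) (realDiagonal_map L dV hdV).symm (JW_eq (Fp L) L a)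
      (isCompatible_chiSplittingLine L e₁ dV hdV hdV0 (toHeckeCharacter L lam) (isUnitary_toHeckeCharacter L lam)
        ((isOscillatorChar_toHeckeCharacter_iff lam).mpr hlam) (TW (Fp L) a) (isSymm_TW (Fp L) a) (isUnit_det_TW (Fp L) a) (JW (Fp L) L a)
        (JW_eq (Fp L) L a))
      hρ Set.univ (fun _ _ _ => Set.mem_univ _) Φ x q
  exact h1.trans (h2.symm.trans h3)

/-- **`conj θ_{Φ,λ,⟨a⟩}(x, q) = θ_{Φ̄,λ₂,⟨−a⟩}(x, q₂)` — the conjugation law of the line theta kernels at the splitting level.**  For conjugate-symplectic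
`λ, λ₂` with `toHeckeCharacter λ₂ = (toHeckeCharacter λ)⁻¹`, a unit `a ∈ (L⁺)ˣ`, theta majorants `hρ` (datum `(λ, ⟨a⟩)`) and `hρ₂` (datum `(λ₂, ⟨−a⟩)`),
`x ∈ U(diag dV)(𝔸)`, and `q ∈ U(⟨a⟩)(𝔸)`, `q₂ ∈ U(⟨−a⟩)(𝔸)` with the same matrix (`U(⟨−a⟩) = U(⟨a⟩)` as matrix groups):
`conj (θ_{λ,a}.thetaKer Φ (mk x, mk q)) = θ_{λ₂,−a}.thetaKer (C Φ) (mk x, mk q₂)`.  Proof: both sides in model currency (`lineThetaKer_mk_eq_thetaDistLM`);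
the splitting of `(λ₂, ⟨−a⟩)` is `splittingCongr (mirrorSplitting ι_{λ̃}⟨a⟩)` (★ `mirror_chiSplittingLine`), whose Weil operators are `C ∘ ω(ι_{λ̃}⟨a⟩ g) ∘ C`
(★ `omega_splittingCongr_mirrorSplitting_apply`), and `Θ ∘ C = conj ∘ Θ` (★ `thetaDistLM_piSchwartzBruhatConj`).
[cite: Liu2021, App. D Lemma D.1 (2)] [cite: Kudla1994, §3 Thm. 3.1] [cite: Li1992, p. 181] [cite: Weil1964, Chap. III n° 41 Thm 6 p. 193] -/
theorem conj_lineThetaKer_mk_eq_neg (lam lam₂ : Literature.NumberTheory.Automorphic.IdeleClassGroup L →ₜ* Circle) (hlam : IsConjugateSymplectic L lam)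
    (hlam₂ : IsConjugateSymplectic L lam₂) (hinv : toHeckeCharacter L lam₂ = (toHeckeCharacter L lam)⁻¹) (a : (Fp L)ˣ)
    (hρ : HasThetaMajorants fun
      (p : ↥(UnitaryGroup.adelic (Fp L) L (IsCMField.complexConj L) N (Matrix.diagonal dV)) ×
        ↥(UnitaryGroup.adelic (Fp L) L (IsCMField.complexConj L) 1 (JW (Fp L) L a)))
      (Φ : piSchwartzBruhat (Fp L) (Fin n')) =>
        pairRep (Fp L) L (IsCMField.complexConj L) N 1 e₁ (Matrix.diagonal dV) (JW (Fp L) L a)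
          (chiSplittingLine L e₁ dV hdV hdV0 (toHeckeCharacter L lam) (isUnitary_toHeckeCharacter L lam)
            ((isOscillatorChar_toHeckeCharacter_iff lam).mpr hlam) (TW (Fp L) a) (isUnit_det_TW (Fp L) a) (JW (Fp L) L a) (JW_eq (Fp L) L a))
          p Φ)
    (hρ₂ : HasThetaMajorants fun
      (p : ↥(UnitaryGroup.adelic (Fp L) L (IsCMField.complexConj L) N (Matrix.diagonal dV)) ×
        ↥(UnitaryGroup.adelic (Fp L) L (IsCMField.complexConj L) 1 (JW (Fp L) L (-a))))
      (Φ : piSchwartzBruhat (Fp L) (Fin n')) =>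
        pairRep (Fp L) L (IsCMField.complexConj L) N 1 e₁ (Matrix.diagonal dV) (JW (Fp L) L (-a))
          (chiSplittingLine L e₁ dV hdV hdV0 (toHeckeCharacter L lam₂) (isUnitary_toHeckeCharacter L lam₂)
            ((isOscillatorChar_toHeckeCharacter_iff lam₂).mpr hlam₂) (TW (Fp L) (-a)) (isUnit_det_TW (Fp L) (-a)) (JW (Fp L) L (-a))
            (JW_eq (Fp L) L (-a)))
          p Φ)
    (Φ : piSchwartzBruhat (Fp L) (Fin n')) (x : ↥(UnitaryGroup.adelic (Fp L) L (IsCMField.complexConj L) N (Matrix.diagonal dV)))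
    (q : ↥(UnitaryGroup.adelic (Fp L) L (IsCMField.complexConj L) 1 (JW (Fp L) L a)))
    (q₂ : ↥(UnitaryGroup.adelic (Fp L) L (IsCMField.complexConj L) 1 (JW (Fp L) L (-a))))
    (hq : (q₂ : GL (Fin 1) (AdeleRing (𝓞 L) L)) = (q : GL (Fin 1) (AdeleRing (𝓞 L) L))) :
    conj ((lineThetaKernelDatum L N e₁ dV hdV hdV0 lam hlam a hρ).thetaKer Φ (QuotientGroup.mk x, QuotientGroup.mk q)) =
      (lineThetaKernelDatum L N e₁ dV hdV hdV0 lam₂ hlam₂ (-a) hρ₂).thetaKer (piSchwartzBruhatConj (Fp L) (Fin n') Φ)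
        (QuotientGroup.mk x, QuotientGroup.mk q₂) := by
  have key₁ := lineThetaKer_mk_eq_thetaDistLM L N e₁ dV hdV hdV0 lam hlam a hρ Φ x q
  have key₂ := lineThetaKer_mk_eq_thetaDistLM L N e₁ dV hdV hdV0 lam₂ hlam₂ (-a) hρ₂ (piSchwartzBruhatConj (Fp L) (Fin n') Φ) x q₂
  -- the splitting of the mirror datum is the transported mirror splitting
  have hs := mirror_chiSplittingLine L e₁ dV hdV hdV0 (toHeckeCharacter L lam) (toHeckeCharacter L lam₂) (isUnitary_toHeckeCharacter L lam)
    ((isOscillatorChar_toHeckeCharacter_iff lam).mpr hlam) (isUnitary_toHeckeCharacter L lam₂)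
    ((isOscillatorChar_toHeckeCharacter_iff lam₂).mpr hlam₂) hinv a
  -- the Weil operator of the mirror datum at `(x⁻¹ ⊗ 1)(1 ⊗ q₂⁻¹)` is `C ∘ ω(s((x⁻¹ ⊗ 1)(1 ⊗ q⁻¹))) ∘ C`
  have h3 := omega_splittingCongr_mirrorSplitting_apply (Fp L) L (IsCMField.complexConj L) N 1 e₁ (Matrix.diagonal dV)
    (chiSplittingLine L e₁ dV hdV hdV0 (toHeckeCharacter L lam) (isUnitary_toHeckeCharacter L lam)
      ((isOscillatorChar_toHeckeCharacter_iff lam).mpr hlam) (TW (Fp L) a) (isUnit_det_TW (Fp L) a) (JW (Fp L) L a) (JW_eq (Fp L) L a))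
    (neg_TW L a) (neg_JW L a) _ _ (coe_pairElem_eq L N dV a x q q₂ hq) (piSchwartzBruhatConj (Fp L) (Fin n') Φ)
  have h4 := congrArg
    (fun s : UnitaryGroup.adelicPair (Fp L) L (IsCMField.complexConj L) N 1 (Matrix.diagonal dV) (JW (Fp L) L (-a)) →*
        adelicMpCont (Fp L) (Fin n') (adelicGram (Fp L) e₁ (realDiagonal L dV hdV) (TW (Fp L) (-a))) =>
      adelicMpCont.omega (Fp L) (Fin n') (adelicGram (Fp L) e₁ (realDiagonal L dV hdV) (TW (Fp L) (-a)))
        (s (UnitaryGroup.adelicInl (Fp L) L (IsCMField.complexConj L) N 1 (Matrix.diagonal dV) (JW (Fp L) L (-a)) x⁻¹ *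
          UnitaryGroup.adelicInr (Fp L) L (IsCMField.complexConj L) N 1 (Matrix.diagonal dV) (JW (Fp L) L (-a)) q₂⁻¹))
        (piSchwartzBruhatConj (Fp L) (Fin n') Φ)) hs.symm
  have h5 := congrArg
    (fun Ψ : piSchwartzBruhat (Fp L) (Fin n') => piSchwartzBruhatConj (Fp L) (Fin n')
      (adelicMpCont.omega (Fp L) (Fin n') (adelicGram (Fp L) e₁ (realDiagonal L dV hdV) (TW (Fp L) a))
        (chiSplittingLine L e₁ dV hdV hdV0 (toHeckeCharacter L lam) (isUnitary_toHeckeCharacter L lam)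
            ((isOscillatorChar_toHeckeCharacter_iff lam).mpr hlam) (TW (Fp L) a) (isUnit_det_TW (Fp L) a) (JW (Fp L) L a) (JW_eq (Fp L) L a)
          (UnitaryGroup.adelicInl (Fp L) L (IsCMField.complexConj L) N 1 (Matrix.diagonal dV) (JW (Fp L) L a) x⁻¹ *
            UnitaryGroup.adelicInr (Fp L) L (IsCMField.complexConj L) N 1 (Matrix.diagonal dV) (JW (Fp L) L a) q⁻¹)) Ψ))
    (piSchwartzBruhatConj_piSchwartzBruhatConj (F := Fp L) (ι := Fin n') Φ)
  have hω := (h4.trans h3).trans h5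
  exact (((congrArg conj key₁).trans (thetaDistLM_piSchwartzBruhatConj _).symm).trans
    (congrArg (thetaDistLM (Fp L) (Fin n')) hω.symm)).trans key₂.symm

end Summit.HodgeConjecture.HodgeConjecture.Cruxes.HLiu418.K2LiuLineThetaKernelMirror

end
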